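/-
Copyright (c) 2026 the pub-hodgecm-mathlib formalisation cell (harness21).  Prover seat hodgecm-mathlib-LH4-p09 (g9), req620 Track A «(D-RAM) FOUR-FRAME» squad
(STAGE-1b, row (2) of the piece `f_{T₊}`, the (β₂) road; dealer∕pen LH4-plan (g13) WORD #102: (β₂-H) owner; statement memo `SIG-beta2H.v1` 8901ac1d of LH4-p04 (g7)), 2026-09-04.
-/
import Summits.HodgeConjecture.HodgeConjecture.Theorems.F0P3cDyRamBlockGlueValueSet   -- ★ p860233 (LH4-p04 (g7)): `valueSet_endoGL_sub_one_glued_eq_plane`, `latticeValueSetMod_endoGL_sub_one_glued_eq_plane`; brings ★ census DEFS (`latticeValueSetMod`, `LatticeLabelPlus`)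
import HarnessLib

/-!
# Crux `H413`, line LH4 «(D-RAM) FOUR-FRAME» — STAGE-1b, row (2), the (β₂) road: (L-blind) «THE TYPE-(2) LABEL OF A GLUED VERTEX IS BLIND TO THE GLUE PARAMETER
# BEYOND ITS NORM» — two glues over the same plane data `(B₂, w₀, b)` whose generators have the same line norm `σ(x₀ 1)·x₀ 1` carry the same value set, hence the same label

Cell `hodgecm-mathlib` (D-0151), FLOOR 0, crux item H413 = `stmt-HodgeConjecture-24833`, route of record `HCCMUnconditional`; squad F0∕P3c∕LH4; lane
`--supports stmt-HodgeConjecture-24833 --as helper` (count-neutral; pays NO tier-0 row).  THEOREMS ONLY (no `def`, no instance, no notation, no `sorry`, default heartbeats).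
DATUM-FREE lattice algebra in the plane letters of ★ p860233 `F0P3cDyRamBlockGlueValueSet` (`K` with `Valued K ℤᵐ⁰`, any `σ : K →+* K`, block form `H = !![H₂ 0 0, 0, H₂ 0 1;
0, h, 0; H₂ 1 0, 0, H₂ 1 1]`, block element `Γ = ι(γ₂, u)`; no self-duality, no `|2|`, no residue field).

WHY.  On a cone cell `(j, b)` of the type-(2) census the fixed vertices are the glued lattices `M = ι_W(B₂) + 𝒪·x₀` over a plane lattice `Λ = φ(B₂) ∈ levelSetDep(j, b; lam − jE u)`,
parametrised (★ T2a∕T2b `UnitaryLatticeTreeBlockGlueFibre[Count]`) by the class of the glue parameter `g = ϖ^b·x₀ 1` in the norm-residue fibre `Sol_{2b}(r_Λ)`; the dual direction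
`w₀ = pr_W x₀` is the canonical dual generator of `B₂`, the SAME for every member of the fibre (the dual trick of ★ T2b).  By ★ p860233 §3 the thickened value set of `Γ − 1` on `M`
reads, in plane letters, `{⟨β′, (γ₂ − u)β′⟩_{H₂} + (u − 1)·(⟨β′, β′⟩_{H₂} + σ(t)·h·t) ∣ β′ = β + a·w₀, t = a·x₀ 1}` thickened by `ϖ^m` — and `σ(t)·h·t = σa·a·h·(σ(x₀ 1)·x₀ 1)` sees
`x₀` ONLY THROUGH THE LINE NORM `N(x₀ 1) = σ(x₀ 1)·x₀ 1`.  Hence: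
* §1 `valueSet_endoGL_sub_one_glued_eq_of_norm_eq` — two glued lattices `M, M′` over the same `(B₂, w₀, b)` with `σ(x₀′ 1)·x₀′ 1 = σ(x₀ 1)·x₀ 1` have the SAME thickened value
  set of `Γ − 1` (every `γ₂, u, m`); `latticeValueSetMod_glued_eq_of_norm_eq` — the same for ★ census DEFS `latticeValueSetMod σ ϖ m · (Γ − 1)` at `Φ₃ = block(Φ₂, 1)`;
  `latticeLabelPlus_glued_iff_of_norm_eq` — hence the SAME label `LatticeLabelPlus σ ϖ d m · (Γ − 1)` (the `+ ∕ −′` bit the piece `f_{T₊}` reads, [Rogawski1990, Prop. 4.9.1 (b)]).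
* §2 `norm_mul_eq_of_mul_map_eq_one` — in particular for `x₀′ 1 = x₀ 1·ε` with `ε` of EXACT norm one (`σε·ε = 1`): rescaling the glue parameter by an exact norm-one element
  NEVER changes the label (`latticeLabelPlus_glued_iff_of_mul_normOne`).
CONSEQUENCE FOR (β₂) (LH4-p04 (g7) `SIG-beta2S.v1` ca422439 ∕ `SIG-beta2H.v1` 8901ac1d; this seat's mechanism memo `MECH-beta2H.v1`): on every cone cell the label factors through
the quotient `Sol_{2b}(r)∕E¹` of the glue fibre by the exact norm-one units; numerically (`norm_one_classes.v1`: ℚ₂(√2) b = 1,2,3: `#Sol_{2b}(1)` = 2, 4, 16 vs `#E¹ mod 𝓂^{2b}` =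
1, 4, 8; ℚ₂(i): 2, 8, 16 vs 2, 4, 8) the fibre is ONE or TWO `E¹`-classes, so a cell's labelled split along the fibre is «constant» or «two classes» — the (β₂-H) involution on a
`b ≥ 1` SPECIFIC cell is multiplication by the non-trivial class `ε₀ ∈ Sol_{2b}(1) ∖ E¹` (fibre-preserving: `|ε₀σε₀ − 1| ≤ |ϖ^{2b}|`), not by an exact norm-one `ε` (which this file
shows to be label-PRESERVING).
HONEST LABEL.  Count-neutral lattice algebra; nothing printed is asserted; no census law is stated; (β₂) stays a HYPOTHESIS; `HC_CM` is proved only modulo the 7 printed citations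
(2 remaining named inputs: hLiu418 = `stmt-HodgeConjecture-24832`, h413 = `stmt-HodgeConjecture-24833`) until rung 0 closes.
## References
* [Jacobowitz1962] R. Jacobowitz, *Hermitian forms over local fields*, Amer. J. Math. 84 (1962): §4 (dual lattices, gluing of modular components, norm residues).
* [Rogawski1990] J. D. Rogawski, *Automorphic Representations of Unitary Groups in Three Variables*, Ann. of Math. Stud. 123 (1990): §4.9 Prop. 4.9.1 (b) p. 55 (the labelled census of `f_{T₊}`).
* [Kottwitz1986BaseChangeUnits] R. E. Kottwitz, *Base change for unit elements of Hecke algebras*, Compositio Math. 60 (1986): §1 pp. 240–241.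
-/

set_option autoImplicit false

noncomputable section
namespace Summit.HodgeConjecture.HodgeConjecture.Cruxes.H413.F0P3cDyRamGlueLabelNormBlind

open scoped Valued WithZero Matrix MatrixGroups
open Literature.NumberTheory.Automorphic Literature.NumberTheory.Automorphic.HermitianLattice Literature.NumberTheory.Automorphic.UnitaryLatticeTree
open Literature.NumberTheory.Rogawski1990
open Summit.HodgeConjecture.HodgeConjecture.Cruxes.H413.F0P3cDyRamBlockGlueValueSet
open Summit.HodgeConjecture.HodgeConjecture.Cruxes.H413.F0P3cDyRamFourFrameCensusDefs (latticeValueSetMod LatticeLabelPlus)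

variable {K : Type*} [Field K] [Valued K ℤᵐ⁰]

/-! ## §1 Two glues with the same line norm carry the same value set, hence the same label -/

omit [Valued K ℤᵐ⁰] in
/-- The line term sees the generator only through its line norm: `σ(a·t′)·h·(a·t′) = σ(a·t)·h·(a·t)` whenever `σt′·t′ = σt·t`. [cite: Jacobowitz1962, §4] -/
theorem lineTerm_eq_of_norm_eq (σ : K →+* K) (h : K) {t t' : K} (hN : σ t' * t' = σ t * t) (a : K) :
    σ (a * t') * h * (a * t') = σ (a * t) * h * (a * t) := by
  rw [map_mul, map_mul]
  linear_combination (σ a * h * a) * hN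

/-- **(L-blind) THE VALUE SET OF `Γ − 1` ON A GLUED VERTEX DEPENDS ON THE GLUE ONLY THROUGH ITS LINE NORM.**  Two lattices `M, M′` with bounded middle coordinates (`|x 1|·|ϖ|^b ≤ 1`),
the same `W`-part `ι_W(B₂)`, generators `x₀ ∈ M`, `x₀′ ∈ M′` of exact middle size `|x₀ 1|·|ϖ|^b = 1 = |x₀′ 1|·|ϖ|^b` over the SAME dual direction `w₀` (`pr_W x₀ = pr_W x₀′ = ι_W w₀`),
and the same line norm `σ(x₀′ 1)·x₀′ 1 = σ(x₀ 1)·x₀ 1`, have the same `ϖ^m`-thickened value set of `y ↦ ⟨y, (Γ − 1)y⟩_H` for every block element `Γ = ι(γ₂, u)` and every `m`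
(★ p860233 `valueSet_endoGL_sub_one_glued_eq_plane` twice + `lineTerm_eq_of_norm_eq`). [cite: Jacobowitz1962, §4] [cite: Rogawski1990, §4.9 Prop. 4.9.1 (b) p. 55] -/
theorem valueSet_endoGL_sub_one_glued_eq_of_norm_eq (σ : K →+* K) {ϖ : K} (hϖ : Valued.v ϖ = WithZero.exp (-1 : ℤ)) (H₂ : Matrix (Fin 2) (Fin 2) K) (h : K)
    {M M' : Submodule 𝒪[K] (Fin 3 → K)} {b : ℕ} (hpr : ∀ x ∈ M, Valued.v (x 1) * Valued.v ϖ ^ b ≤ 1) (hpr' : ∀ x ∈ M', Valued.v (x 1) * Valued.v ϖ ^ b ≤ 1)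
    {B₂ : Submodule 𝒪[K] (Fin 2 → K)} {w₀ : Fin 2 → K} {x₀ x₀' : Fin 3 → K}
    (hB : B₂.map ((Matrix.toLin' (!![1, 0; 0, 0; 0, 1] : Matrix (Fin 3) (Fin 2) K)).restrictScalars 𝒪[K]) =
      M ⊓ LinearMap.ker ((LinearMap.proj (1 : Fin 3) : (Fin 3 → K) →ₗ[K] K).restrictScalars 𝒪[K]))
    (hB' : B₂.map ((Matrix.toLin' (!![1, 0; 0, 0; 0, 1] : Matrix (Fin 3) (Fin 2) K)).restrictScalars 𝒪[K]) =
      M' ⊓ LinearMap.ker ((LinearMap.proj (1 : Fin 3) : (Fin 3 → K) →ₗ[K] K).restrictScalars 𝒪[K]))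
    (hx₀ : x₀ ∈ M) (hx₀' : x₀' ∈ M') (hx₀1 : Valued.v (x₀ 1) * Valued.v ϖ ^ b = 1) (hx₀'1 : Valued.v (x₀' 1) * Valued.v ϖ ^ b = 1)
    (hprx : x₀ - Pi.single 1 (x₀ 1) = ![w₀ 0, 0, w₀ 1]) (hprx' : x₀' - Pi.single 1 (x₀' 1) = ![w₀ 0, 0, w₀ 1])
    (hN : σ (x₀' 1) * x₀' 1 = σ (x₀ 1) * x₀ 1) (γ₂ : GL (Fin 2) K) (u : GL (Fin 1) K) (m : ℕ) :
    {z : K | ∃ y ∈ M, Valued.v ((ϖ ^ m)⁻¹ * (z - pairing σ (!![H₂ 0 0, 0, H₂ 0 1; 0, h, 0; H₂ 1 0, 0, H₂ 1 1] : Matrix (Fin 3) (Fin 3) K) y ((((endoGL (γ₂, u) : GL (Fin 3) K) : Matrix (Fin 3) (Fin 3) K) - 1) *ᵥ y))) ≤ 1} =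
      {z : K | ∃ y ∈ M', Valued.v ((ϖ ^ m)⁻¹ * (z - pairing σ (!![H₂ 0 0, 0, H₂ 0 1; 0, h, 0; H₂ 1 0, 0, H₂ 1 1] : Matrix (Fin 3) (Fin 3) K) y ((((endoGL (γ₂, u) : GL (Fin 3) K) : Matrix (Fin 3) (Fin 3) K) - 1) *ᵥ y))) ≤ 1} := by
  rw [valueSet_endoGL_sub_one_glued_eq_plane σ hϖ H₂ h hpr hB hx₀ hx₀1 hprx γ₂ u m,
    valueSet_endoGL_sub_one_glued_eq_plane σ hϖ H₂ h hpr' hB' hx₀' hx₀'1 hprx' γ₂ u m]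
  simp only [lineTerm_eq_of_norm_eq σ h hN]

/-- **(L-blind) FOR THE CENSUS LETTER `latticeValueSetMod`.**  At `Φ₃ = block(Φ₂, 1)` (★ p860233 §4): two glued vertices over the same `(B₂, w₀, b)` with the same line norm have the
same ★ census DEFS `latticeValueSetMod σ ϖ m · (Γ − 1)`. [cite: Jacobowitz1962, §4] [cite: Rogawski1990, §4.9 Prop. 4.9.1 (b) p. 55] -/
theorem latticeValueSetMod_glued_eq_of_norm_eq (σ : K →+* K) {ϖ : K} (hϖ : Valued.v ϖ = WithZero.exp (-1 : ℤ))
    {M M' : Submodule 𝒪[K] (Fin 3 → K)} {b : ℕ} (hpr : ∀ x ∈ M, Valued.v (x 1) * Valued.v ϖ ^ b ≤ 1) (hpr' : ∀ x ∈ M', Valued.v (x 1) * Valued.v ϖ ^ b ≤ 1)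
    {B₂ : Submodule 𝒪[K] (Fin 2 → K)} {w₀ : Fin 2 → K} {x₀ x₀' : Fin 3 → K}
    (hB : B₂.map ((Matrix.toLin' (!![1, 0; 0, 0; 0, 1] : Matrix (Fin 3) (Fin 2) K)).restrictScalars 𝒪[K]) =
      M ⊓ LinearMap.ker ((LinearMap.proj (1 : Fin 3) : (Fin 3 → K) →ₗ[K] K).restrictScalars 𝒪[K]))
    (hB' : B₂.map ((Matrix.toLin' (!![1, 0; 0, 0; 0, 1] : Matrix (Fin 3) (Fin 2) K)).restrictScalars 𝒪[K]) =
      M' ⊓ LinearMap.ker ((LinearMap.proj (1 : Fin 3) : (Fin 3 → K) →ₗ[K] K).restrictScalars 𝒪[K]))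
    (hx₀ : x₀ ∈ M) (hx₀' : x₀' ∈ M') (hx₀1 : Valued.v (x₀ 1) * Valued.v ϖ ^ b = 1) (hx₀'1 : Valued.v (x₀' 1) * Valued.v ϖ ^ b = 1)
    (hprx : x₀ - Pi.single 1 (x₀ 1) = ![w₀ 0, 0, w₀ 1]) (hprx' : x₀' - Pi.single 1 (x₀' 1) = ![w₀ 0, 0, w₀ 1])
    (hN : σ (x₀' 1) * x₀' 1 = σ (x₀ 1) * x₀ 1) (γ₂ : GL (Fin 2) K) (u : GL (Fin 1) K) (m : ℕ) :
    latticeValueSetMod σ ϖ m M (((endoGL (γ₂, u) : GL (Fin 3) K) : Matrix (Fin 3) (Fin 3) K) - 1) =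
      latticeValueSetMod σ ϖ m M' (((endoGL (γ₂, u) : GL (Fin 3) K) : Matrix (Fin 3) (Fin 3) K) - 1) := by
  rw [latticeValueSetMod_endoGL_sub_one_glued_eq_plane σ hϖ hpr hB hx₀ hx₀1 hprx γ₂ u m,
    latticeValueSetMod_endoGL_sub_one_glued_eq_plane σ hϖ hpr' hB' hx₀' hx₀'1 hprx' γ₂ u m]
  simp only [lineTerm_eq_of_norm_eq σ (1 : K) hN]

/-- **(L-blind) FOR THE LABEL.**  Two glued vertices over the same `(B₂, w₀, b)` with the same line norm carry the same transvection label `LatticeLabelPlus σ ϖ d m · (Γ − 1)` — the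
`+ ∕ −′` bit read by the piece `f_{T₊}`. [cite: Rogawski1990, §4.9 Prop. 4.9.1 (b) p. 55] [cite: Jacobowitz1962, §4] -/
theorem latticeLabelPlus_glued_iff_of_norm_eq (σ : K →+* K) {ϖ : K} (hϖ : Valued.v ϖ = WithZero.exp (-1 : ℤ))
    {M M' : Submodule 𝒪[K] (Fin 3 → K)} {b : ℕ} (hpr : ∀ x ∈ M, Valued.v (x 1) * Valued.v ϖ ^ b ≤ 1) (hpr' : ∀ x ∈ M', Valued.v (x 1) * Valued.v ϖ ^ b ≤ 1)
    {B₂ : Submodule 𝒪[K] (Fin 2 → K)} {w₀ : Fin 2 → K} {x₀ x₀' : Fin 3 → K}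
    (hB : B₂.map ((Matrix.toLin' (!![1, 0; 0, 0; 0, 1] : Matrix (Fin 3) (Fin 2) K)).restrictScalars 𝒪[K]) =
      M ⊓ LinearMap.ker ((LinearMap.proj (1 : Fin 3) : (Fin 3 → K) →ₗ[K] K).restrictScalars 𝒪[K]))
    (hB' : B₂.map ((Matrix.toLin' (!![1, 0; 0, 0; 0, 1] : Matrix (Fin 3) (Fin 2) K)).restrictScalars 𝒪[K]) =
      M' ⊓ LinearMap.ker ((LinearMap.proj (1 : Fin 3) : (Fin 3 → K) →ₗ[K] K).restrictScalars 𝒪[K]))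
    (hx₀ : x₀ ∈ M) (hx₀' : x₀' ∈ M') (hx₀1 : Valued.v (x₀ 1) * Valued.v ϖ ^ b = 1) (hx₀'1 : Valued.v (x₀' 1) * Valued.v ϖ ^ b = 1)
    (hprx : x₀ - Pi.single 1 (x₀ 1) = ![w₀ 0, 0, w₀ 1]) (hprx' : x₀' - Pi.single 1 (x₀' 1) = ![w₀ 0, 0, w₀ 1])
    (hN : σ (x₀' 1) * x₀' 1 = σ (x₀ 1) * x₀ 1) (γ₂ : GL (Fin 2) K) (u : GL (Fin 1) K) (d m : ℕ) :
    LatticeLabelPlus σ ϖ d m M (((endoGL (γ₂, u) : GL (Fin 3) K) : Matrix (Fin 3) (Fin 3) K) - 1) ↔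
      LatticeLabelPlus σ ϖ d m M' (((endoGL (γ₂, u) : GL (Fin 3) K) : Matrix (Fin 3) (Fin 3) K) - 1) := by
  unfold Summit.HodgeConjecture.HodgeConjecture.Cruxes.H413.F0P3cDyRamFourFrameCensusDefs.LatticeLabelPlus
  rw [latticeValueSetMod_glued_eq_of_norm_eq σ hϖ hpr hpr' hB hB' hx₀ hx₀' hx₀1 hx₀'1 hprx hprx' hN γ₂ u m]

/-! ## §2 Exact norm-one rescaling of the glue never changes the label -/

omit [Valued K ℤᵐ⁰] in
/-- An exact norm-one rescaling preserves the line norm: `σ(t·ε)·(t·ε) = σt·t` for `σε·ε = 1`. [cite: Jacobowitz1962, §4] -/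
theorem norm_mul_eq_of_mul_map_eq_one (σ : K →+* K) (t : K) {ε : K} (hε : σ ε * ε = 1) : σ (t * ε) * (t * ε) = σ t * t := by
  rw [map_mul]
  linear_combination (σ t * t) * hε

/-- **EXACT NORM-ONE GLUE RESCALING IS LABEL-PRESERVING.**  If the second generator's middle coordinate is the first's times an exact norm-one `ε` (`σε·ε = 1`) — i.e. the two
glued vertices sit in the same `E¹`-class of the norm-residue fibre `Sol_{2b}(r)` — then they carry the same label.  (So the (β₂-H) label-reversing symmetry of a tube cell is NOT an
exact norm-one rescaling; it is the non-trivial class of `Sol_{2b}(1)∕E¹`.) [cite: Rogawski1990, §4.9 Prop. 4.9.1 (b) p. 55] [cite: Jacobowitz1962, §4] -/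
theorem latticeLabelPlus_glued_iff_of_mul_normOne (σ : K →+* K) {ϖ : K} (hϖ : Valued.v ϖ = WithZero.exp (-1 : ℤ))
    {M M' : Submodule 𝒪[K] (Fin 3 → K)} {b : ℕ} (hpr : ∀ x ∈ M, Valued.v (x 1) * Valued.v ϖ ^ b ≤ 1) (hpr' : ∀ x ∈ M', Valued.v (x 1) * Valued.v ϖ ^ b ≤ 1)
    {B₂ : Submodule 𝒪[K] (Fin 2 → K)} {w₀ : Fin 2 → K} {x₀ x₀' : Fin 3 → K}
    (hB : B₂.map ((Matrix.toLin' (!![1, 0; 0, 0; 0, 1] : Matrix (Fin 3) (Fin 2) K)).restrictScalars 𝒪[K]) =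
      M ⊓ LinearMap.ker ((LinearMap.proj (1 : Fin 3) : (Fin 3 → K) →ₗ[K] K).restrictScalars 𝒪[K]))
    (hB' : B₂.map ((Matrix.toLin' (!![1, 0; 0, 0; 0, 1] : Matrix (Fin 3) (Fin 2) K)).restrictScalars 𝒪[K]) =
      M' ⊓ LinearMap.ker ((LinearMap.proj (1 : Fin 3) : (Fin 3 → K) →ₗ[K] K).restrictScalars 𝒪[K]))
    (hx₀ : x₀ ∈ M) (hx₀' : x₀' ∈ M') (hx₀1 : Valued.v (x₀ 1) * Valued.v ϖ ^ b = 1) (hx₀'1 : Valued.v (x₀' 1) * Valued.v ϖ ^ b = 1)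
    (hprx : x₀ - Pi.single 1 (x₀ 1) = ![w₀ 0, 0, w₀ 1]) (hprx' : x₀' - Pi.single 1 (x₀' 1) = ![w₀ 0, 0, w₀ 1])
    {ε : K} (hε : σ ε * ε = 1) (hxε : x₀' 1 = x₀ 1 * ε) (γ₂ : GL (Fin 2) K) (u : GL (Fin 1) K) (d m : ℕ) :
    LatticeLabelPlus σ ϖ d m M (((endoGL (γ₂, u) : GL (Fin 3) K) : Matrix (Fin 3) (Fin 3) K) - 1) ↔
      LatticeLabelPlus σ ϖ d m M' (((endoGL (γ₂, u) : GL (Fin 3) K) : Matrix (Fin 3) (Fin 3) K) - 1) :=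
  latticeLabelPlus_glued_iff_of_norm_eq σ hϖ hpr hpr' hB hB' hx₀ hx₀' hx₀1 hx₀'1 hprx hprx'
    (by rw [hxε]; exact norm_mul_eq_of_mul_map_eq_one σ (x₀ 1) hε) γ₂ u d m

end Summit.HodgeConjecture.HodgeConjecture.Cruxes.H413.F0P3cDyRamGlueLabelNormBlind

end
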